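import Literature.AlgebraicGeometry.HodgeTheory.ChartConjugationCanonicalOfAffine
import Literature.AlgebraicGeometry.HodgeTheory.ConjRealizeClosedProofs
import Literature.AlgebraicGeometry.HodgeTheory.AnalyticModelRealizePullback
import Literature.AlgebraicGeometry.HodgeTheory.AbsoluteHodgeClassesDegreeZero
import Literature.NumberTheory.Transcendental.DeRhamTheoremProofs
import HarnessLib

/-!
# `chartConjugation_canonical` from Grothendieck's comparison datum and de Rham rigidity

Family `hodge`, layer `Literature/AlgebraicGeometry/HodgeTheory` (theorems, two small operations on
form expressions and the auxiliary conjugation maps they feed; no named fact; net debt 0). Lane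
`lit-hodgefound`, row S3b of the V-B2′ programme — the sequel of `ChartConjugationCanonicalOfAffine`
(S3a), which reduced the named fact `chartConjugation_canonical` (`ConjugationChartUniqueness`:
Charles–Schnell, *Notes on absolute Hodge classes*, §11.2.2 (11.2.2)–(11.2.3) read through
Grothendieck's comparison theorem) to an AFFINE conjugation datum: maps
`θ_Y : Hᵏ(Y(ℂ); ℂ) → Hᵏ(Y^σ(ℂ); ℂ)` which are (a) `σ`-semilinear, (b) natural for `ℂ`-morphisms between
smooth affine `ℂ`-schemes and (c) computed by charts (clause (iii) of the fact).

**What is proved.** The affine datum — hence `chartConjugation_canonical`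
(`chartConjugation_canonical_of_comparison`) — is CONSTRUCTED from exactly the three printed inputs
that the census of the fact isolates, taken as hypotheses ((G) is the tree's existing named fact, an
explicit argument `hG`; (G-inj) and (Rig) are inline binders; no new named fact is introduced):

* (G) `grothendieck_comparison_realize_surjective` (the tree's named fact, `ConjugationChartExistence`):
  on a smooth affine `Y`, every complex de Rham class of `Y^an` is the class of the realisation of an
  algebraic form expression — the SURJECTIVITY half of Grothendieck's `H•(Γ(Y, Ω•)) ⥲ H•(Y^an; ℂ)`
  (Grothendieck 1966, Thm. 1′);
* (G-inj) its INJECTIVITY half carried along `ξ ↦ ξ^σ`: if the class of `ξ.realize A` vanishes, so does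
  the class of `(ξ.conj σ).realize A'` (a closed regular form with zero complex class is `dη` with `η`
  regular, Grothendieck 1966 Thm. 1′, and `(dη)^σ = d(η^σ)`, Charles–Schnell (11.2.2)) — verbatim the
  conclusion of the tree's `complexDeRhamCohomology_mk_conj_eq_zero_of_canonical`
  (`ConjugationChartUniquenessProofs`), "the kernel statement every proof of the fact must supply";
* (Rig) RIGIDITY of natural complex de Rham families: a natural family on `E`-manifolds which is
  rationally normalised in degree `k` is, in degree `k` and on every `E`-manifold, a RATIONAL constant
  multiple of the complexified integration family `(integrationDeRhamIsoFamily E).complexify`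
  (`DeRhamTheoremProofs`) — junk analysis (2) of `AbsoluteHodgeClasses`: a natural automorphism of
  `Hᵏ(–; ℂ)` on `E`-manifolds is a scalar, since rational homology classes are Steenrod representable
  up to odd multiples (Conner–Floyd (15.3)) by maps of thickened closed `k`-manifolds `P × ℝ^{2m-k}`,
  compared with `Sᵏ × ℝ^{2m-k}` by degree-one maps, and `Hᵏ(M; ℂ) = Hom(H_k(M; ℤ), ℂ)`; the scalar is
  rational by the normalisation on tori.

**How (Charles–Schnell (11.2.3) on a smooth affine `Y`, made chart-free).** Fix `σ`, `k`. Say an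
expression `ξ` READS `c ∈ Hᵏ(Y(ℂ); ℂ)` on an analytic model `A` (`AnalyticModel.RefReads`) if its
realisation is closed and `A^* c = (∫ ⊗ ℂ)[ξ.realize A]` for the REFERENCE family `∫ ⊗ ℂ` (the
complexified integration family) of the model space of `A`. Readings are transported between any two analytic models of `Y`, on any two model
spaces (`RefReads.of_model`: the comparison biholomorphism `𝟙^an`, `AnalyticModelRealizePullback`, and
the naturality of the integration families ACROSS model spaces,
`integrationDeRhamIsoFamily_complexify_natural₂`), and pulled back along `ℂ`-morphisms
(`RefReads.pullback_hom`); by (G-inj), two expressions reading one class have conjugates with one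
class (`RefReads.mk_conj_eq`). Hence (§3) the CHART CONJUGATION `chartConj A A' c` — the class `d` with
`A'^* d = (∫ ⊗ ℂ)[ξ_c^σ.realize A']` for a (G)-representative `ξ_c` of `c` on `A` and its conjugate realised
on `A'` (closed by `conj_realize_mem_cclosedSmoothForms_holds`) — is read through EVERY pair of models
and EVERY expression reading `c` (`chartConj_readout`, the transfer lemma `RefReads.transfer`); it is
`σ`-semilinear (`chartConj_smul_add`: `(a ξ₁ + ξ₂)^σ = σ(a) ξ₁^σ + ξ₂^σ` on presentations,
`AlgFormExpr.add`/`AlgFormExpr.smul`, conjugation of constants being `σ`,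
`appTop_baseChangeHomFst_constSection`) and natural (`chartConj_map`: `(g^* ξ)^σ = (g^σ)^* ξ^σ`,
`AlgFormExpr.conj_pullback`). Clause (iii) for an ARBITRARY natural rationally normalised family `e`
is where (Rig) enters: `e = q · ∫` with `q ∈ ℚ`, so `A^* c = e[ξ]` says that `q · ξ` reads `c`, and the
read-out of `chartConj` through `(q ξ)^σ = σ(q) ξ^σ = q ξ^σ` is `e[ξ^σ]` because `σ` FIXES `ℚ`
(`comparisonConj_chart`) — with a non-rational constant the chart clause would fail by `q/σ(q)`, which
is why the fact asks for rational normalisation. §4 chooses reference models on `ℂᵐ`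
(`nonempty_analyticModel_of_isAffine`) to define `θ_Y` on smooth affine `Y` (`comparisonConj`; `0`
elsewhere) and §5 assembles with `chartConjugation_canonical_of_affine`.

Not here: proofs of (G), (G-inj), (Rig) — the three remaining inputs of V-B2′, each a theory
(hypercohomology/GAGA for (G), (G-inj); Thom realisation for (Rig)).

## References

* F. Charles, C. Schnell, *Notes on absolute Hodge classes*, in *Hodge Theory*, Math. Notes 49 (2014),
  §11.2.2 (11.2.1)–(11.2.3), Thm. 11.1.2 and the Remark following it. [CharlesSchnell2014Notes]
* A. Grothendieck, *On the de Rham cohomology of algebraic varieties*, Publ. IHÉS 29 (1966), Thm. 1′.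
  [Grothendieck1966]
* P. E. Conner, E. E. Floyd, *Differentiable periodic maps* (1964), (15.3). [ConnerFloyd1964]
* J.-P. Serre, *Géométrie algébrique et géométrie analytique*, Ann. Inst. Fourier 6 (1956), §2 n°5.
  [SerreGAGA1956]
* J. M. Lee, *Introduction to Smooth Manifolds*, 2nd ed. (2013), Thm. 18.14. [LeeSmoothManifolds2013]
-/

noncomputable section

open CategoryTheory AlgebraicGeometry
open scoped Manifold ContDiff
open Literature.NumberTheory.Transcendental Literature.Geometry.Kaehler
open Literature.AlgebraicTopology.SingularHomology
open Literature.AlgebraicGeometry.Motives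

namespace Literature.AlgebraicGeometry.HodgeTheory

section HodgeTheory

/-! ### §1 Sums, scalar multiples and pull-backs of form expressions, and their conjugates -/

namespace AlgFormExpr

variable {Y : SchemeOver ℂ} {k : ℕ}

/-- The **sum** of two algebraic `k`-form expressions: concatenation of their lists of monomials
(`∑ⱼ fⱼ dg_{j,•} + ∑ⱼ f'ⱼ dg'_{j,•}`). [cite: Grothendieck1966, Thm. 1'] -/
def add (ξ₁ ξ₂ : AlgFormExpr Y k) : AlgFormExpr Y k where
  size := ξ₁.size + ξ₂.size
  coef := Fin.append ξ₁.coef ξ₂.coef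
  arg := Fin.append ξ₁.arg ξ₂.arg

/-- The **scalar multiple** `a · ξ` of an algebraic `k`-form expression by a constant `a ∈ ℂ`: every
coefficient is multiplied by the constant global function `a · 1` (`constSection`).
[cite: Grothendieck1966, Thm. 1'] -/
def smul (a : ℂ) (ξ : AlgFormExpr Y k) : AlgFormExpr Y k where
  size := ξ.size
  coef j := constSection Y a * ξ.coef j
  arg := ξ.arg

/-- The **difference** `ξ₁ - ξ₂ := ξ₁ + (-1) · ξ₂` of two expressions. [cite: Grothendieck1966, Thm. 1'] -/
def sub (ξ₁ ξ₂ : AlgFormExpr Y k) : AlgFormExpr Y k :=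
  ξ₁.add (ξ₂.smul (-1))

variable {E : Type} [NormedAddCommGroup E] [NormedSpace ℂ E] [FiniteDimensional ℂ E] {m : ℕ}

/-- The sum of expressions realises to the sum of the realisations. [cite: Grothendieck1966, Thm. 1'] -/
theorem realize_add (ξ₁ ξ₂ : AlgFormExpr Y k) (A : AnalyticModel E m Y) :
    (ξ₁.add ξ₂).realize A = ξ₁.realize A + ξ₂.realize A := by
  unfold realize add
  dsimp only
  rw [Fin.sum_univ_add]
  simp only [Fin.append_left, Fin.append_right]

/-- The scalar multiple `a · ξ` realises to `a •` the realisation (on an affine `Y`, where regular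
functions read multiplicatively on `Y^an`). [cite: Grothendieck1966, Thm. 1'] -/
theorem realize_smul [IsAffine Y.left] (a : ℂ) (ξ : AlgFormExpr Y k) (A : AnalyticModel E m Y) :
    (ξ.smul a).realize A = a • ξ.realize A := by
  unfold realize smul
  dsimp only
  rw [Finset.smul_sum]
  refine Finset.sum_congr rfl fun j _ ↦ ?_
  funext x
  simp only [Pi.smul_apply, AnalyticModel.regularFun_mul, AnalyticModel.regularFun_constSection,
    smul_smul]

/-- The difference of expressions realises to the difference of the realisations.
[cite: Grothendieck1966, Thm. 1'] -/
theorem realize_sub [IsAffine Y.left] (ξ₁ ξ₂ : AlgFormExpr Y k) (A : AnalyticModel E m Y) :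
    (ξ₁.sub ξ₂).realize A = ξ₁.realize A - ξ₂.realize A := by
  rw [sub, realize_add, realize_smul, neg_one_smul, sub_eq_add_neg]

/-- **`(ξ₁ + ξ₂)^σ` realises to `ξ₁^σ + ξ₂^σ`** (conjugation of presentations is additive).
[cite: CharlesSchnell2014Notes, §11.2.2 (11.2.2)] -/
theorem realize_conj_add (σ : ℂ ≃+* ℂ) (ξ₁ ξ₂ : AlgFormExpr Y k)
    (A' : AnalyticModel E m (conjugateVariety σ Y)) :
    ((ξ₁.add ξ₂).conj σ).realize A' = (ξ₁.conj σ).realize A' + (ξ₂.conj σ).realize A' := by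
  unfold realize conj add
  dsimp only
  rw [Fin.sum_univ_add]
  simp only [Fin.append_left, Fin.append_right]

/-- **`(a · ξ)^σ` realises to `σ(a) • ξ^σ`**: conjugation of constants is `σ`
(`appTop_baseChangeHomFst_constSection`) — Charles–Schnell's `(λα)^σ = σ(λ) α^σ` on presentations.
[cite: CharlesSchnell2014Notes, §11.2.2 (11.2.3)] -/
theorem realize_conj_smul [IsAffine Y.left] (σ : ℂ ≃+* ℂ) (a : ℂ) (ξ : AlgFormExpr Y k)
    (A' : AnalyticModel E m (conjugateVariety σ Y)) :
    ((ξ.smul a).conj σ).realize A' = σ a • (ξ.conj σ).realize A' := by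
  -- conjugated coefficients read multiplicatively on `(Y^σ)^an`, and the conjugate of the constant
  -- `a` is the constant `σ a`
  have hc : ∀ (s : Γ(Y.left, ⊤)) (x : A'.carrier),
      A'.regularFun ((baseChangeHomFst σ.toRingHom Y).appTop (constSection Y a * s)) x =
        σ a * A'.regularFun ((baseChangeHomFst σ.toRingHom Y).appTop s) x := by
    intro s x
    rw [map_mul, appTop_baseChangeHomFst_constSection]
    exact (congrFun (AnalyticModel.regularFun_mul A' _ _) x).trans
      (by simp only [AnalyticModel.regularFun_constSection])
  unfold realize conj smul
  dsimp only
  rw [Finset.smul_sum]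
  refine Finset.sum_congr rfl fun j _ ↦ ?_
  funext x
  simp only [Pi.smul_apply, hc, smul_smul]

/-- `(ξ₁ - ξ₂)^σ` realises to `ξ₁^σ - ξ₂^σ`. [cite: CharlesSchnell2014Notes, §11.2.2 (11.2.2)] -/
theorem realize_conj_sub [IsAffine Y.left] (σ : ℂ ≃+* ℂ) (ξ₁ ξ₂ : AlgFormExpr Y k)
    (A' : AnalyticModel E m (conjugateVariety σ Y)) :
    ((ξ₁.sub ξ₂).conj σ).realize A' = (ξ₁.conj σ).realize A' - (ξ₂.conj σ).realize A' := by
  rw [sub, realize_conj_add, realize_conj_smul, map_neg, map_one, neg_one_smul, sub_eq_add_neg]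

/-- **Conjugation commutes with pull-back of expressions**: `(g^* ξ)^σ = (g^σ)^* (ξ^σ)` for a
`ℂ`-morphism `g : Y' ⟶ Y` (the projections `Y^σ → Y` are natural: `g^σ ≫ pr_Y = pr_{Y'} ≫ g`,
`baseChangeHom_map_left_comp_fst`). [cite: CharlesSchnell2014Notes, §11.2.2 (11.2.1)–(11.2.2)] -/
theorem conj_pullback (σ : ℂ ≃+* ℂ) {Y' : SchemeOver ℂ} (g : Y' ⟶ Y) (ξ : AlgFormExpr Y k) :
    (ξ.pullback g).conj σ = (ξ.conj σ).pullback (conjHom σ g) := by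
  have key : ∀ s : Γ(Y.left, ⊤),
      (baseChangeHomFst σ.toRingHom Y').appTop (g.left.appTop s) =
        (conjHom σ g).left.appTop ((baseChangeHomFst σ.toRingHom Y).appTop s) := by
    intro s
    have h := congrArg (fun φ ↦ φ.appTop s) (baseChangeHom_map_left_comp_fst σ.toRingHom g)
    simp only [Scheme.Hom.comp_appTop, CommRingCat.comp_apply] at h
    exact h.symm
  unfold conj pullback
  dsimp only
  simp only [key]

end AlgFormExpr

/-! ### §2 Reading classes through expressions and the REFERENCE de Rham families `∫ ⊗ ℂ` -/

-- The REFERENCE complex de Rham family on `E`-manifolds is the complexified integration family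
-- `(integrationDeRhamIsoFamily E).complexify` of `DeRhamTheoremProofs`.

section Reads

variable {E : Type} [NormedAddCommGroup E] [NormedSpace ℂ E] [FiniteDimensional ℂ E]
  {E₁ : Type} [NormedAddCommGroup E₁] [NormedSpace ℂ E₁] [FiniteDimensional ℂ E₁]
  {E₂ : Type} [NormedAddCommGroup E₂] [NormedSpace ℂ E₂] [FiniteDimensional ℂ E₂]
  {m m₁ m₂ : ℕ} {Y Y' : SchemeOver ℂ} {k : ℕ} {σ : ℂ ≃+* ℂ}

/-- **`ξ` reads `c` on the analytic model `A`** (w.r.t. the reference family): the realisation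
`ξ.realize A` is closed and `A^* c = (∫ ⊗ ℂ)[ξ.realize A]` in `Hᵏ(Y^an; ℂ)` — "the class of the closed
algebraic form `ξ` goes to `c` under Grothendieck's comparison followed by `Y^an ≃ Y(ℂ)`".
[cite: Grothendieck1966, Thm. 1'] -/
def AnalyticModel.RefReads (A : AnalyticModel E m Y) (ξ : AlgFormExpr Y k) (c : complexBetti Y k) :
    Prop :=
  ∃ hξ : ξ.realize A ∈ cclosedSmoothForms E A.carrier k,
    A.pullback k c = (integrationDeRhamIsoFamily E).complexify A.carrier k (complexDeRhamCohomology.mk E A.carrier k ⟨ξ.realize A, hξ⟩)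

namespace AnalyticModel.RefReads

/-- A reading expression has closed realisation. [cite: Grothendieck1966, Thm. 1'] -/
theorem mem {A : AnalyticModel E m Y} {ξ : AlgFormExpr Y k} {c : complexBetti Y k}
    (h : A.RefReads ξ c) : ξ.realize A ∈ cclosedSmoothForms E A.carrier k :=
  h.fst

/-- The defining identity `A^* c = (∫ ⊗ ℂ)[ξ.realize A]` of a reading (for any closedness witness).
[cite: Grothendieck1966, Thm. 1'] -/
theorem eq {A : AnalyticModel E m Y} {ξ : AlgFormExpr Y k} {c : complexBetti Y k}
    (h : A.RefReads ξ c) (hξ : ξ.realize A ∈ cclosedSmoothForms E A.carrier k) :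
    A.pullback k c = (integrationDeRhamIsoFamily E).complexify A.carrier k (complexDeRhamCohomology.mk E A.carrier k ⟨ξ.realize A, hξ⟩) :=
  h.snd

/-- **Readings pull back along `ℂ`-morphisms**, across model spaces: if `ξ` reads `c` on a model `A₂`
of the smooth affine `Y`, then `g^* ξ` reads `g^* c` on any model `A₁` of the smooth `Y'`, for
`g : Y' ⟶ Y` (`A₁^* g^* = (g^an)^* A₂^*`, `(g^an)^* (ξ.realize A₂) = (g^* ξ).realize A₁`, and the
naturality of the integration families across model spaces, Lee Thm. 18.14).
[cite: SerreGAGA1956, §2 n°5] [cite: LeeSmoothManifolds2013, Thm. 18.14] -/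
theorem pullback_hom [IsAffine Y.left] [SmoothOfRelativeDimension m₁ Y'.hom]
    [SmoothOfRelativeDimension m₂ Y.hom] {A₂ : AnalyticModel E₂ m₂ Y} {ξ : AlgFormExpr Y k}
    {c : complexBetti Y k} (h : A₂.RefReads ξ c) (A₁ : AnalyticModel E₁ m₁ Y') (g : Y' ⟶ Y) :
    A₁.RefReads (ξ.pullback g) (complexBetti.map g k c) := by
  obtain ⟨hξ, hc⟩ := h
  refine ⟨ξ.realize_pullback_mem_cclosedSmoothForms A₁ A₂ g hξ, ?_⟩
  rw [A₁.pullback_map_eq A₂ g c, hc,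
    ← integrationDeRhamIsoFamily_complexify_natural₂ (A₁.contMDiff_anMap A₂ g) k,
    ξ.map_mk_realize_anMap A₁ A₂ g hξ (ξ.realize_pullback_mem_cclosedSmoothForms A₁ A₂ g hξ)]

/-- **Readings do not depend on the analytic model, nor on the model space**: if `ξ` reads `c` on a
model `B` of the smooth affine `Y` then it reads `c` on every model `A` (the comparison biholomorphism
`𝟙^an = ψ_B⁻¹ ∘ ψ_A`, Serre GAGA §2 n°5 Prop. 2). [cite: SerreGAGA1956, §2 n°5 Prop. 2] -/
theorem of_model [IsAffine Y.left] [SmoothOfRelativeDimension m₁ Y.hom]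
    [SmoothOfRelativeDimension m₂ Y.hom] {B : AnalyticModel E₂ m₂ Y} {ξ : AlgFormExpr Y k}
    {c : complexBetti Y k} (h : B.RefReads ξ c) (A : AnalyticModel E₁ m₁ Y) : A.RefReads ξ c := by
  simpa only [AlgFormExpr.pullback_id, complexBetti.map_id, ModuleCat.id_apply] using
    h.pullback_hom A (𝟙 Y)

/-- Readings add: `ξ₁ + ξ₂` reads `c₁ + c₂`. [cite: Grothendieck1966, Thm. 1'] -/
theorem add {A : AnalyticModel E m Y} {ξ₁ ξ₂ : AlgFormExpr Y k} {c₁ c₂ : complexBetti Y k}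
    (h₁ : A.RefReads ξ₁ c₁) (h₂ : A.RefReads ξ₂ c₂) : A.RefReads (ξ₁.add ξ₂) (c₁ + c₂) := by
  obtain ⟨hm₁, e₁⟩ := h₁
  obtain ⟨hm₂, e₂⟩ := h₂
  have hmem : (ξ₁.add ξ₂).realize A ∈ cclosedSmoothForms E A.carrier k := by
    rw [AlgFormExpr.realize_add]
    exact add_mem hm₁ hm₂
  refine ⟨hmem, ?_⟩
  have hx : (⟨(ξ₁.add ξ₂).realize A, hmem⟩ : cclosedSmoothForms E A.carrier k) = ⟨_, hm₁⟩ + ⟨_, hm₂⟩ :=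
    Subtype.ext (AlgFormExpr.realize_add ξ₁ ξ₂ A)
  rw [hx, map_add, map_add, map_add, e₁, e₂]

/-- Readings scale: `a · ξ` reads `a • c` (affine `Y`). [cite: Grothendieck1966, Thm. 1'] -/
theorem smul [IsAffine Y.left] {A : AnalyticModel E m Y} {ξ : AlgFormExpr Y k} {c : complexBetti Y k}
    (h : A.RefReads ξ c) (a : ℂ) : A.RefReads (ξ.smul a) (a • c) := by
  obtain ⟨hm, e⟩ := h
  have hmem : (ξ.smul a).realize A ∈ cclosedSmoothForms E A.carrier k := by
    rw [AlgFormExpr.realize_smul]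
    exact Submodule.smul_mem _ a hm
  refine ⟨hmem, ?_⟩
  have hx : (⟨(ξ.smul a).realize A, hmem⟩ : cclosedSmoothForms E A.carrier k) = a • ⟨_, hm⟩ :=
    Subtype.ext (AlgFormExpr.realize_smul a ξ A)
  rw [hx, map_smul, map_smul, map_smul, e]

/-- **From an arbitrary family to the reference family.** If `A^* c = e[ξ.realize A]` for a family `e`
which is `q · (∫ ⊗ ℂ)` in degree `k` on all `E`-manifolds, then `q · ξ` reads `c` on `A`.
[cite: CharlesSchnell2014Notes, §11.2.2 (11.2.3)] -/
theorem smul_of_eq [IsAffine Y.left] {A : AnalyticModel E m Y} {ξ : AlgFormExpr Y k}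
    {c : complexBetti Y k} {e : ComplexDeRhamIsoFamily E} {q : ℂ}
    (hq : ∀ (M : Type) [TopologicalSpace M] [ChartedSpace E M] [IsManifold 𝓘(ℝ, E) ∞ M] [T2Space M]
      [SigmaCompactSpace M] (x : complexDeRhamCohomology E M k), e M k x = q • (integrationDeRhamIsoFamily E).complexify M k x)
    (hξ : ξ.realize A ∈ cclosedSmoothForms E A.carrier k)
    (hc : A.pullback k c = e A.carrier k (complexDeRhamCohomology.mk E A.carrier k ⟨_, hξ⟩)) :
    A.RefReads (ξ.smul q) c := by
  have hmem : (ξ.smul q).realize A ∈ cclosedSmoothForms E A.carrier k := by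
    rw [AlgFormExpr.realize_smul]
    exact Submodule.smul_mem _ q hξ
  refine ⟨hmem, ?_⟩
  have hx : (⟨(ξ.smul q).realize A, hmem⟩ : cclosedSmoothForms E A.carrier k) = q • ⟨_, hξ⟩ :=
    Subtype.ext (AlgFormExpr.realize_smul q ξ A)
  rw [hx, map_smul, map_smul, hc, hq]

/-- **Back to an arbitrary family, through `σ`.** If `(q · ξ)^σ` reads `d` on a model `A'` of `Y^σ` with
`q` RATIONAL, and `e = q · (∫ ⊗ ℂ)` in degree `k` on `E`-manifolds, then `A'^* d = e[ξ^σ.realize A']`: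
`(q ξ)^σ = σ(q) ξ^σ = q ξ^σ` because `σ` fixes `ℚ` — the one place where the RATIONAL normalisation of
the de Rham family is used. [cite: CharlesSchnell2014Notes, §11.2.2 (11.2.3)] -/
theorem eq_of_conj_smul [IsAffine Y.left] {A' : AnalyticModel E m (conjugateVariety σ Y)}
    {ξ : AlgFormExpr Y k} {d : complexBetti (conjugateVariety σ Y) k} {e : ComplexDeRhamIsoFamily E}
    {q : ℚ}
    (hq : ∀ (M : Type) [TopologicalSpace M] [ChartedSpace E M] [IsManifold 𝓘(ℝ, E) ∞ M] [T2Space M]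
      [SigmaCompactSpace M] (x : complexDeRhamCohomology E M k), e M k x = (q : ℂ) • (integrationDeRhamIsoFamily E).complexify M k x)
    (h : A'.RefReads ((ξ.smul (q : ℂ)).conj σ) d)
    (hξ' : (ξ.conj σ).realize A' ∈ cclosedSmoothForms E A'.carrier k) :
    A'.pullback k d = e A'.carrier k (complexDeRhamCohomology.mk E A'.carrier k ⟨_, hξ'⟩) := by
  obtain ⟨hm, hd⟩ := h
  have hx : (⟨((ξ.smul (q : ℂ)).conj σ).realize A', hm⟩ : cclosedSmoothForms E A'.carrier k) =
      (q : ℂ) • ⟨_, hξ'⟩ :=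
    Subtype.ext (show ((ξ.smul (q : ℂ)).conj σ).realize A' = (q : ℂ) • (ξ.conj σ).realize A' by
      rw [AlgFormExpr.realize_conj_smul, map_ratCast])
  rw [hd, hx, map_smul, map_smul, hq]

/-- **Two expressions reading one class have conjugates with one class**, granted the injectivity
half (G-inj) of Grothendieck's comparison on the model pair `(A, A')`: `(∫ ⊗ ℂ)` is injective, so
`[ξ₁.realize A] = [ξ₂.realize A]`, i.e. `[(ξ₁ - ξ₂).realize A] = 0`; by (G-inj) `[(ξ₁ - ξ₂)^σ.realize A'] = 0`,
and `(ξ₁ - ξ₂)^σ = ξ₁^σ - ξ₂^σ`. This is the well-definedness of `α ↦ α^σ` on cohomology.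
[cite: CharlesSchnell2014Notes, §11.2.2 (11.2.2)–(11.2.3)] [cite: Grothendieck1966, Thm. 1'] -/
theorem mk_conj_eq [IsAffine Y.left] {A : AnalyticModel E m Y}
    {A' : AnalyticModel E m (conjugateVariety σ Y)}
    (hInj : ∀ (ξ : AlgFormExpr Y k) (hξ : ξ.realize A ∈ cclosedSmoothForms E A.carrier k)
      (hξ' : (ξ.conj σ).realize A' ∈ cclosedSmoothForms E A'.carrier k),
      complexDeRhamCohomology.mk E A.carrier k ⟨_, hξ⟩ = 0 →
        complexDeRhamCohomology.mk E A'.carrier k ⟨_, hξ'⟩ = 0)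
    {ξ₁ ξ₂ : AlgFormExpr Y k} {c : complexBetti Y k} (h₁ : A.RefReads ξ₁ c) (h₂ : A.RefReads ξ₂ c)
    (h₁' : (ξ₁.conj σ).realize A' ∈ cclosedSmoothForms E A'.carrier k)
    (h₂' : (ξ₂.conj σ).realize A' ∈ cclosedSmoothForms E A'.carrier k) :
    complexDeRhamCohomology.mk E A'.carrier k ⟨_, h₁'⟩ =
      complexDeRhamCohomology.mk E A'.carrier k ⟨_, h₂'⟩ := by
  obtain ⟨hm₁, e₁⟩ := h₁
  obtain ⟨hm₂, e₂⟩ := h₂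
  -- the classes of `ξ₁`, `ξ₂` on `A` agree
  have h12 : complexDeRhamCohomology.mk E A.carrier k ⟨_, hm₁⟩ =
      complexDeRhamCohomology.mk E A.carrier k ⟨_, hm₂⟩ :=
    ((integrationDeRhamIsoFamily E).complexify A.carrier k).injective (e₁.symm.trans e₂)
  -- so the difference has class `0`, and so does its conjugate
  have hs : (ξ₁.sub ξ₂).realize A ∈ cclosedSmoothForms E A.carrier k := by
    rw [AlgFormExpr.realize_sub]
    exact sub_mem hm₁ hm₂
  have hs' : ((ξ₁.sub ξ₂).conj σ).realize A' ∈ cclosedSmoothForms E A'.carrier k := by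
    rw [AlgFormExpr.realize_conj_sub]
    exact sub_mem h₁' h₂'
  have h0 : complexDeRhamCohomology.mk E A.carrier k ⟨_, hs⟩ = 0 := by
    have hx : (⟨(ξ₁.sub ξ₂).realize A, hs⟩ : cclosedSmoothForms E A.carrier k) = ⟨_, hm₁⟩ - ⟨_, hm₂⟩ :=
      Subtype.ext (AlgFormExpr.realize_sub ξ₁ ξ₂ A)
    rw [hx, map_sub, h12, sub_self]
  have h0' := hInj (ξ₁.sub ξ₂) hs hs' h0
  have hx' : (⟨((ξ₁.sub ξ₂).conj σ).realize A', hs'⟩ : cclosedSmoothForms E A'.carrier k) =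
      ⟨_, h₁'⟩ - ⟨_, h₂'⟩ :=
    Subtype.ext (AlgFormExpr.realize_conj_sub σ ξ₁ ξ₂ A')
  rwa [hx', map_sub, sub_eq_zero] at h0'

/-- **Transfer lemma (chart independence).** Let `ξ₁` read `c` on a model `A₁` (model space `E₁`) and `ξ₂`
read the same `c` on a model `A₂` (model space `E₂`) of the smooth affine `Y`, and suppose (G-inj) on the
pair `(A₁, A₁')`. If `ξ₁^σ` reads `d` on `A₁'` then `ξ₂^σ` reads `d` on `A₂'`: transport `ξ₂` to `A₁`
(`of_model`), compare conjugate classes there (`mk_conj_eq`; `ξ₂^σ` is closed by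
`conj_realize_mem_cclosedSmoothForms_holds`), transport back to `A₂'`.
[cite: CharlesSchnell2014Notes, §11.2.2 (11.2.3)] [cite: SerreGAGA1956, §2 n°5 Prop. 2] -/
theorem transfer [IsAffine Y.left] [SmoothOfRelativeDimension m₁ Y.hom]
    [SmoothOfRelativeDimension m₂ Y.hom] {A₁ : AnalyticModel E₁ m₁ Y}
    {A₁' : AnalyticModel E₁ m₁ (conjugateVariety σ Y)}
    (hInj : ∀ (ξ : AlgFormExpr Y k) (hξ : ξ.realize A₁ ∈ cclosedSmoothForms E₁ A₁.carrier k)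
      (hξ' : (ξ.conj σ).realize A₁' ∈ cclosedSmoothForms E₁ A₁'.carrier k),
      complexDeRhamCohomology.mk E₁ A₁.carrier k ⟨_, hξ⟩ = 0 →
        complexDeRhamCohomology.mk E₁ A₁'.carrier k ⟨_, hξ'⟩ = 0)
    {A₂ : AnalyticModel E₂ m₂ Y} (A₂' : AnalyticModel E₂ m₂ (conjugateVariety σ Y))
    {ξ₁ ξ₂ : AlgFormExpr Y k} {c : complexBetti Y k} {d : complexBetti (conjugateVariety σ Y) k}
    (h₁ : A₁.RefReads ξ₁ c) (h₂ : A₂.RefReads ξ₂ c) (hd : A₁'.RefReads (ξ₁.conj σ) d) :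
    A₂'.RefReads (ξ₂.conj σ) d := by
  have h₂₁ : A₁.RefReads ξ₂ c := h₂.of_model A₁
  have hc₂' : (ξ₂.conj σ).realize A₁' ∈ cclosedSmoothForms E₁ A₁'.carrier k :=
    conj_realize_mem_cclosedSmoothForms_holds σ m₁ Y E₁ A₁ A₁' k ξ₂ h₂₁.mem
  obtain ⟨hc₁', e₁⟩ := hd
  have hd₂ : A₁'.RefReads (ξ₂.conj σ) d := ⟨hc₂', by rw [e₁, mk_conj_eq hInj h₁ h₂₁ hc₁' hc₂']⟩
  exact hd₂.of_model A₂'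

end AnalyticModel.RefReads

end Reads

/-! ### §3 The chart conjugation of a model pair and its chart independence -/

section Chart

variable {E : Type} [NormedAddCommGroup E] [NormedSpace ℂ E] [FiniteDimensional ℂ E]
  {E₁ : Type} [NormedAddCommGroup E₁] [NormedSpace ℂ E₁] [FiniteDimensional ℂ E₁]
  {m m₁ : ℕ} {Y Y' : SchemeOver ℂ} [IsAffine Y.left] [SmoothOfRelativeDimension m Y.hom]

/-- **A Grothendieck representative** of `c ∈ Hᵏ(Y(ℂ); ℂ)` on the model `A`: an algebraic `k`-form
expression whose (closed) realisation has class `(∫ ⊗ ℂ)⁻¹ (A^* c)` — a choice licensed by the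
comparison datum (G), taken as the hypothesis `hG`. [cite: Grothendieck1966, Thm. 1'] -/
def AnalyticModel.deRhamRep (hG : grothendieck_comparison_realize_surjective) (k : ℕ)
    (A : AnalyticModel E m Y) (c : complexBetti Y k) : AlgFormExpr Y k :=
  (hG m Y E A k (((integrationDeRhamIsoFamily E).complexify A.carrier k).symm (A.pullback k c))).choose

/-- The Grothendieck representative has closed realisation. [cite: Grothendieck1966, Thm. 1'] -/
theorem AnalyticModel.deRhamRep_mem (hG : grothendieck_comparison_realize_surjective) (k : ℕ)
    (A : AnalyticModel E m Y) (c : complexBetti Y k) :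
    (A.deRhamRep hG k c).realize A ∈ cclosedSmoothForms E A.carrier k :=
  (hG m Y E A k (((integrationDeRhamIsoFamily E).complexify A.carrier k).symm (A.pullback k c))).choose_spec.fst

/-- The Grothendieck representative of `c` reads `c`. [cite: Grothendieck1966, Thm. 1'] -/
theorem AnalyticModel.deRhamRep_refReads (hG : grothendieck_comparison_realize_surjective) (k : ℕ)
    (A : AnalyticModel E m Y) (c : complexBetti Y k) : A.RefReads (A.deRhamRep hG k c) c := by
  refine ⟨A.deRhamRep_mem hG k c, ?_⟩
  have h : complexDeRhamCohomology.mk E A.carrier k ⟨(A.deRhamRep hG k c).realize A, A.deRhamRep_mem hG k c⟩ =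
      ((integrationDeRhamIsoFamily E).complexify A.carrier k).symm (A.pullback k c) :=
    (hG m Y E A k (((integrationDeRhamIsoFamily E).complexify A.carrier k).symm (A.pullback k c))).choose_spec.snd
  rw [h, LinearEquiv.apply_symm_apply]

/-- The conjugate of the Grothendieck representative has closed realisation on any model of `Y^σ`
(input (C), the theorem `conj_realize_mem_cclosedSmoothForms_holds`).
[cite: CharlesSchnell2014Notes, §11.2.2 (11.2.2)] -/
theorem AnalyticModel.deRhamRep_conj_mem (hG : grothendieck_comparison_realize_surjective)
    (σ : ℂ ≃+* ℂ) (k : ℕ) (A : AnalyticModel E m Y) (A' : AnalyticModel E m (conjugateVariety σ Y))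
    (c : complexBetti Y k) :
    ((A.deRhamRep hG k c).conj σ).realize A' ∈ cclosedSmoothForms E A'.carrier k :=
  conj_realize_mem_cclosedSmoothForms_holds σ m Y E A A' k _ (A.deRhamRep_mem hG k c)

/-- **The chart conjugation** `θ_{A,A'} : Hᵏ(Y(ℂ); ℂ) → Hᵏ(Y^σ(ℂ); ℂ)` of a pair of analytic models of the
smooth affine `Y` and of `Y^σ` on one model space: `θ c` is THE class `d` with
`A'^* d = (∫ ⊗ ℂ)[ξ_c^σ.realize A']`, `ξ_c` the Grothendieck representative of `c` on `A` (`A'^*` is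
bijective). This is Charles–Schnell's `α ↦ α^σ` (11.2.3) read in singular cohomology through the
comparison isomorphisms, computed in the chart `(A, A')`. [cite: CharlesSchnell2014Notes, §11.2.2 (11.2.3)] -/
def chartConj (hG : grothendieck_comparison_realize_surjective) (σ : ℂ ≃+* ℂ) (k : ℕ)
    (A : AnalyticModel E m Y) (A' : AnalyticModel E m (conjugateVariety σ Y)) (c : complexBetti Y k) :
    complexBetti (conjugateVariety σ Y) k :=
  (A'.pullback_surjective k
    ((integrationDeRhamIsoFamily E).complexify A'.carrier k (complexDeRhamCohomology.mk E A'.carrier k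
      ⟨((A.deRhamRep hG k c).conj σ).realize A', A.deRhamRep_conj_mem hG σ k A' c⟩))).choose

/-- Defining identity: `ξ_c^σ` reads `θ_{A,A'} c` on `A'`. [cite: CharlesSchnell2014Notes, §11.2.2 (11.2.3)] -/
theorem chartConj_refReads (hG : grothendieck_comparison_realize_surjective) (σ : ℂ ≃+* ℂ) (k : ℕ)
    (A : AnalyticModel E m Y) (A' : AnalyticModel E m (conjugateVariety σ Y)) (c : complexBetti Y k) :
    A'.RefReads ((A.deRhamRep hG k c).conj σ) (chartConj hG σ k A A' c) :=
  ⟨A.deRhamRep_conj_mem hG σ k A' c, (A'.pullback_surjective k _).choose_spec⟩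

/-- **Chart independence of the chart conjugation** (granted (G-inj) on `(A, A')`): `θ_{A,A'} c` is read,
on ANY model `A₂'` of `Y^σ`, through the conjugate `ξ^σ` of ANY expression `ξ` reading `c` on ANY model
`A₂` of `Y` (any model space). This is "all charts agree" — the content of clause (iii) of
`chartConjugation_canonical` — from the uniqueness of analytifications and Grothendieck's theorem.
[cite: CharlesSchnell2014Notes, §11.2.2 (11.2.3)] [cite: SerreGAGA1956, §2 n°5 Prop. 2] -/
theorem chartConj_readout (hG : grothendieck_comparison_realize_surjective) (σ : ℂ ≃+* ℂ) (k : ℕ)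
    (A : AnalyticModel E m Y) (A' : AnalyticModel E m (conjugateVariety σ Y))
    (hInj : ∀ (ξ : AlgFormExpr Y k) (hξ : ξ.realize A ∈ cclosedSmoothForms E A.carrier k)
      (hξ' : (ξ.conj σ).realize A' ∈ cclosedSmoothForms E A'.carrier k),
      complexDeRhamCohomology.mk E A.carrier k ⟨_, hξ⟩ = 0 →
        complexDeRhamCohomology.mk E A'.carrier k ⟨_, hξ'⟩ = 0)
    {E₂ : Type} [NormedAddCommGroup E₂] [NormedSpace ℂ E₂] [FiniteDimensional ℂ E₂]
    {m₂ : ℕ} [SmoothOfRelativeDimension m₂ Y.hom] {A₂ : AnalyticModel E₂ m₂ Y}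
    (A₂' : AnalyticModel E₂ m₂ (conjugateVariety σ Y)) {ξ : AlgFormExpr Y k} {c : complexBetti Y k}
    (hξ : A₂.RefReads ξ c) : A₂'.RefReads (ξ.conj σ) (chartConj hG σ k A A' c) :=
  AnalyticModel.RefReads.transfer hInj A₂' (A.deRhamRep_refReads hG k c) hξ (chartConj_refReads hG σ k A A' c)

/-- **The chart conjugation is `σ`-semilinear** (granted (G-inj) on `(A, A')`): `a ξ₁ + ξ₂` reads
`a c₁ + c₂`, and `(a ξ₁ + ξ₂)^σ = σ(a) ξ₁^σ + ξ₂^σ` — Charles–Schnell's `(λα)^σ = σ(λ) α^σ` (11.2.3).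
[cite: CharlesSchnell2014Notes, §11.2.2 (11.2.3)] -/
theorem chartConj_smul_add (hG : grothendieck_comparison_realize_surjective) (σ : ℂ ≃+* ℂ) (k : ℕ)
    (A : AnalyticModel E m Y) (A' : AnalyticModel E m (conjugateVariety σ Y))
    (hInj : ∀ (ξ : AlgFormExpr Y k) (hξ : ξ.realize A ∈ cclosedSmoothForms E A.carrier k)
      (hξ' : (ξ.conj σ).realize A' ∈ cclosedSmoothForms E A'.carrier k),
      complexDeRhamCohomology.mk E A.carrier k ⟨_, hξ⟩ = 0 →
        complexDeRhamCohomology.mk E A'.carrier k ⟨_, hξ'⟩ = 0)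
    (a : ℂ) (c₁ c₂ : complexBetti Y k) :
    chartConj hG σ k A A' (a • c₁ + c₂) = σ a • chartConj hG σ k A A' c₁ + chartConj hG σ k A A' c₂ := by
  apply A'.pullback_injective k
  have hr : A.RefReads (((A.deRhamRep hG k c₁).smul a).add (A.deRhamRep hG k c₂)) (a • c₁ + c₂) :=
    ((A.deRhamRep_refReads hG k c₁).smul a).add (A.deRhamRep_refReads hG k c₂)
  obtain ⟨hm, e⟩ := chartConj_readout hG σ k A A' hInj A' hr
  obtain ⟨hm₁, e₁⟩ := chartConj_refReads hG σ k A A' c₁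
  obtain ⟨hm₂, e₂⟩ := chartConj_refReads hG σ k A A' c₂
  rw [e, map_add, map_smul, e₁, e₂]
  have hx : (⟨((((A.deRhamRep hG k c₁).smul a).add (A.deRhamRep hG k c₂)).conj σ).realize A', hm⟩ :
      cclosedSmoothForms E A'.carrier k) = σ a • ⟨_, hm₁⟩ + ⟨_, hm₂⟩ :=
    Subtype.ext (by
      simp only [Submodule.coe_add, Submodule.coe_smul, AlgFormExpr.realize_conj_add,
        AlgFormExpr.realize_conj_smul])
  rw [hx, map_add, map_smul, map_add, map_smul]

/-- **The chart conjugation is natural** for a `ℂ`-morphism `g : Y' ⟶ Y` of smooth affine schemes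
(granted (G-inj) on the model pair `(A₁, A₁')` of `Y'`): `θ_{A₁,A₁'} (g^* c) = (g^σ)^* (θ_{A,A'} c)` —
`g^* ξ_c` reads `g^* c`, `(g^σ)^* ξ_c^σ` reads `(g^σ)^* (θ c)`, and `(g^* ξ_c)^σ = (g^σ)^* ξ_c^σ`
(functoriality of `α ↦ α^σ` and of the comparison isomorphism, Grothendieck 1966 p. 96).
[cite: CharlesSchnell2014Notes, §11.2.2 (11.2.2)–(11.2.3)] [cite: Grothendieck1966, Thm. 1'] -/
theorem chartConj_map (hG : grothendieck_comparison_realize_surjective) (σ : ℂ ≃+* ℂ) (k : ℕ)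
    (A : AnalyticModel E m Y) (A' : AnalyticModel E m (conjugateVariety σ Y))
    [IsAffine Y'.left] [SmoothOfRelativeDimension m₁ Y'.hom]
    (A₁ : AnalyticModel E₁ m₁ Y') (A₁' : AnalyticModel E₁ m₁ (conjugateVariety σ Y'))
    (hInj₁ : ∀ (ξ : AlgFormExpr Y' k) (hξ : ξ.realize A₁ ∈ cclosedSmoothForms E₁ A₁.carrier k)
      (hξ' : (ξ.conj σ).realize A₁' ∈ cclosedSmoothForms E₁ A₁'.carrier k),
      complexDeRhamCohomology.mk E₁ A₁.carrier k ⟨_, hξ⟩ = 0 →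
        complexDeRhamCohomology.mk E₁ A₁'.carrier k ⟨_, hξ'⟩ = 0)
    (g : Y' ⟶ Y) (c : complexBetti Y k) :
    chartConj hG σ k A₁ A₁' (complexBetti.map g k c) =
      complexBetti.map (conjHom σ g) k (chartConj hG σ k A A' c) := by
  apply A₁'.pullback_injective k
  -- `g^* ξ_c` reads `g^* c` on `A₁`, so `θ₁ (g^* c)` is read through `(g^* ξ_c)^σ` on `A₁'`
  have hr : A₁.RefReads ((A.deRhamRep hG k c).pullback g) (complexBetti.map g k c) :=
    (A.deRhamRep_refReads hG k c).pullback_hom A₁ g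
  obtain ⟨hm, e⟩ := chartConj_readout hG σ k A₁ A₁' hInj₁ A₁' hr
  -- `(g^σ)^* ξ_c^σ` reads `(g^σ)^* (θ c)` on `A₁'`
  obtain ⟨hm', e'⟩ := (chartConj_refReads hG σ k A A' c).pullback_hom A₁' (conjHom σ g)
  have hx : (⟨(((A.deRhamRep hG k c).pullback g).conj σ).realize A₁', hm⟩ :
      cclosedSmoothForms E₁ A₁'.carrier k) =
      ⟨(((A.deRhamRep hG k c).conj σ).pullback (conjHom σ g)).realize A₁', hm'⟩ :=
    Subtype.ext (by simp only [AlgFormExpr.conj_pullback])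
  rw [e, e', hx]

end Chart

/-! ### §4 The affine conjugation datum: reference charts on `ℂᵐ` -/

section Affine

/-- **A comparison chart** of a `ℂ`-scheme `Y` (auxiliary structure): a witness that `Y` is smooth
affine of some relative dimension `m`, with analytic models of `Y` and `Y^σ` charted on `ℂᵐ`. Every
smooth affine `Y` has one (`nonempty_comparisonChart`). [cite: SerreGAGA1956, §2 n°5 Prop. 2] -/
structure ComparisonChart (σ : ℂ ≃+* ℂ) (Y : SchemeOver ℂ) : Type 1 where
  /-- The relative dimension of `Y`. [cite: SerreGAGA1956, §2] -/
  m : ℕ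
  /-- `Y` is affine. [cite: SerreGAGA1956, §2] -/
  isAffine : IsAffine Y.left
  /-- `Y` is smooth over `ℂ` of relative dimension `m`. [cite: SerreGAGA1956, §2] -/
  smooth : SmoothOfRelativeDimension m Y.hom
  /-- An analytic model of `Y` on `ℂᵐ`. [cite: SerreGAGA1956, §2 n°5 Prop. 2] -/
  an : AnalyticModel (Fin m → ℂ) m Y
  /-- An analytic model of `Y^σ` on `ℂᵐ`. [cite: CharlesSchnell2014Notes, §11.2.2 (11.2.1)] -/
  anConj : AnalyticModel (Fin m → ℂ) m (conjugateVariety σ Y)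

/-- **Smooth affine schemes have comparison charts** (`nonempty_analyticModel_of_isAffine` for `Y` and
for `Y^σ`, which is smooth affine of the same dimension). [cite: SerreGAGA1956, §2 n°5 Prop. 2] -/
theorem nonempty_comparisonChart (σ : ℂ ≃+* ℂ) (m : ℕ) (Y : SchemeOver ℂ) [IsAffine Y.left]
    [SmoothOfRelativeDimension m Y.hom] : Nonempty (ComparisonChart σ Y) := by
  obtain ⟨A⟩ := nonempty_analyticModel_of_isAffine m Y
  obtain ⟨A'⟩ := nonempty_analyticModel_of_isAffine m (conjugateVariety σ Y)
  exact ⟨⟨m, ‹_›, ‹_›, A, A'⟩⟩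

namespace ComparisonChart

variable {σ : ℂ ≃+* ℂ} {Y : SchemeOver ℂ}

/-- The chart conjugation of a comparison chart. [cite: CharlesSchnell2014Notes, §11.2.2 (11.2.3)] -/
def conjMap (hG : grothendieck_comparison_realize_surjective) (k : ℕ) (R : ComparisonChart σ Y) :
    complexBetti Y k → complexBetti (conjugateVariety σ Y) k :=
  haveI := R.isAffine
  haveI := R.smooth
  chartConj hG σ k R.an R.anConj

end ComparisonChart

open Classical in
/-- **The affine conjugation datum** `θ_Y : Hᵏ(Y(ℂ); ℂ) → Hᵏ(Y^σ(ℂ); ℂ)`: the chart conjugation of a chosen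
comparison chart when `Y` is smooth affine, `0` otherwise (where clauses (b), (c) impose nothing).
[cite: CharlesSchnell2014Notes, §11.2.2 (11.2.3)] -/
def comparisonConj (hG : grothendieck_comparison_realize_surjective) (σ : ℂ ≃+* ℂ) (k : ℕ)
    (Y : SchemeOver ℂ) : complexBetti Y k → complexBetti (conjugateVariety σ Y) k :=
  if h : Nonempty (ComparisonChart σ Y) then (Classical.choice h).conjMap hG k else 0

/-- On a scheme with a comparison chart, `θ_Y` is the chart conjugation of the chosen chart (unfolding).
[cite: CharlesSchnell2014Notes, §11.2.2 (11.2.3)] -/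
theorem comparisonConj_eq (hG : grothendieck_comparison_realize_surjective) (σ : ℂ ≃+* ℂ) (k : ℕ)
    {Y : SchemeOver ℂ} (h : Nonempty (ComparisonChart σ Y)) :
    comparisonConj hG σ k Y = (Classical.choice h).conjMap hG k := by
  rw [comparisonConj, dif_pos h]

/-- Off smooth affine schemes, `θ_Y = 0` (unfolding). [cite: CharlesSchnell2014Notes, §11.2.2 (11.2.3)] -/
theorem comparisonConj_of_not (hG : grothendieck_comparison_realize_surjective) (σ : ℂ ≃+* ℂ) (k : ℕ)
    {Y : SchemeOver ℂ} (h : ¬ Nonempty (ComparisonChart σ Y)) :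
    comparisonConj hG σ k Y = 0 := by
  rw [comparisonConj, dif_neg h]

/-- **(a) `θ` is `σ`-semilinear** on every `ℂ`-scheme (granted (G-inj) on model pairs of smooth affine
schemes). [cite: CharlesSchnell2014Notes, §11.2.2 (11.2.3)] -/
theorem comparisonConj_smul_add (hG : grothendieck_comparison_realize_surjective) (σ : ℂ ≃+* ℂ)
    (k : ℕ)
    (hInj : ∀ (m : ℕ) (Y : SchemeOver ℂ) [IsAffine Y.left] [SmoothOfRelativeDimension m Y.hom]
      (E : Type) [NormedAddCommGroup E] [NormedSpace ℂ E] [FiniteDimensional ℂ E]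
      (A : AnalyticModel E m Y) (A' : AnalyticModel E m (conjugateVariety σ Y))
      (ξ : AlgFormExpr Y k) (hξ : ξ.realize A ∈ cclosedSmoothForms E A.carrier k)
      (hξ' : (ξ.conj σ).realize A' ∈ cclosedSmoothForms E A'.carrier k),
      complexDeRhamCohomology.mk E A.carrier k ⟨_, hξ⟩ = 0 →
        complexDeRhamCohomology.mk E A'.carrier k ⟨_, hξ'⟩ = 0)
    (Y : SchemeOver ℂ) (a : ℂ) (c₁ c₂ : complexBetti Y k) :
    comparisonConj hG σ k Y (a • c₁ + c₂) =
      σ a • comparisonConj hG σ k Y c₁ + comparisonConj hG σ k Y c₂ := by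
  by_cases h : Nonempty (ComparisonChart σ Y)
  · rw [comparisonConj_eq hG σ k h]
    set R := Classical.choice h
    haveI := R.isAffine
    haveI := R.smooth
    exact chartConj_smul_add hG σ k R.an R.anConj (hInj R.m Y (Fin R.m → ℂ) R.an R.anConj) a c₁ c₂
  · rw [comparisonConj_of_not hG σ k h]
    simp only [Pi.zero_apply, smul_zero, add_zero]

/-- **(b) `θ` is natural for `ℂ`-morphisms between smooth affine `ℂ`-schemes** (granted (G-inj)):
`θ_{Y'} (g^* c) = (g^σ)^* (θ_Y c)`. [cite: CharlesSchnell2014Notes, §11.2.2 (11.2.2)–(11.2.3)] -/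
theorem comparisonConj_map (hG : grothendieck_comparison_realize_surjective) (σ : ℂ ≃+* ℂ)
    (k : ℕ)
    (hInj : ∀ (m : ℕ) (Y : SchemeOver ℂ) [IsAffine Y.left] [SmoothOfRelativeDimension m Y.hom]
      (E : Type) [NormedAddCommGroup E] [NormedSpace ℂ E] [FiniteDimensional ℂ E]
      (A : AnalyticModel E m Y) (A' : AnalyticModel E m (conjugateVariety σ Y))
      (ξ : AlgFormExpr Y k) (hξ : ξ.realize A ∈ cclosedSmoothForms E A.carrier k)
      (hξ' : (ξ.conj σ).realize A' ∈ cclosedSmoothForms E A'.carrier k),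
      complexDeRhamCohomology.mk E A.carrier k ⟨_, hξ⟩ = 0 →
        complexDeRhamCohomology.mk E A'.carrier k ⟨_, hξ'⟩ = 0)
    ⦃Y Y' : SchemeOver ℂ⦄ (g : Y' ⟶ Y) (m m' : ℕ) [IsAffine Y.left]
    [SmoothOfRelativeDimension m Y.hom] [IsAffine Y'.left] [SmoothOfRelativeDimension m' Y'.hom]
    (c : complexBetti Y k) :
    comparisonConj hG σ k Y' (complexBetti.map g k c) =
      complexBetti.map (conjHom σ g) k (comparisonConj hG σ k Y c) := by
  have hY := nonempty_comparisonChart σ m Y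
  have hY' := nonempty_comparisonChart σ m' Y'
  rw [comparisonConj_eq hG σ k hY, comparisonConj_eq hG σ k hY']
  set R := Classical.choice hY
  set R' := Classical.choice hY'
  haveI := R.smooth
  haveI := R'.smooth
  exact chartConj_map hG σ k R.an R.anConj R'.an R'.anConj
    (hInj R'.m Y' (Fin R'.m → ℂ) R'.an R'.anConj) g c

/-- **(c) `θ` is computed by charts** (clause (iii) of `chartConjugation_canonical`): for ANY model space
`E`, ANY natural complex de Rham family `e` on `E`-manifolds rationally normalised in degree `k`, ANY
models `A`, `A'` of `Y`, `Y^σ` on `E` and ANY expression `ξ` with closed realisations,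
`A^* c = e[ξ.realize A] → A'^* (θ_Y c) = e[(ξ.conj σ).realize A']`. By (Rig) `e = q · (∫ ⊗ ℂ)` with `q ∈ ℚ`;
then `q ξ` reads `c`, `θ_Y c` is read through `(q ξ)^σ` on `A'` (chart independence), and
`(q ξ)^σ = q ξ^σ` as `σ` fixes `ℚ`. [cite: CharlesSchnell2014Notes, §11.2.2 (11.2.3)] [cite: ConnerFloyd1964, (15.3)] -/
theorem comparisonConj_chart (hG : grothendieck_comparison_realize_surjective) (σ : ℂ ≃+* ℂ)
    (k : ℕ)
    (hInj : ∀ (m : ℕ) (Y : SchemeOver ℂ) [IsAffine Y.left] [SmoothOfRelativeDimension m Y.hom]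
      (E : Type) [NormedAddCommGroup E] [NormedSpace ℂ E] [FiniteDimensional ℂ E]
      (A : AnalyticModel E m Y) (A' : AnalyticModel E m (conjugateVariety σ Y))
      (ξ : AlgFormExpr Y k) (hξ : ξ.realize A ∈ cclosedSmoothForms E A.carrier k)
      (hξ' : (ξ.conj σ).realize A' ∈ cclosedSmoothForms E A'.carrier k),
      complexDeRhamCohomology.mk E A.carrier k ⟨_, hξ⟩ = 0 →
        complexDeRhamCohomology.mk E A'.carrier k ⟨_, hξ'⟩ = 0)
    (hRig : ∀ (E : Type) [NormedAddCommGroup E] [NormedSpace ℂ E] [FiniteDimensional ℂ E]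
      (e : ComplexDeRhamIsoFamily E), e.IsNatural → IsRationalDeRhamFamily e k →
      ∃ q : ℚ, ∀ (M : Type) [TopologicalSpace M] [ChartedSpace E M] [IsManifold 𝓘(ℝ, E) ∞ M]
        [T2Space M] [SigmaCompactSpace M] (x : complexDeRhamCohomology E M k),
        e M k x = (q : ℂ) • (integrationDeRhamIsoFamily E).complexify M k x)
    (E : Type) [NormedAddCommGroup E] [NormedSpace ℂ E] [FiniteDimensional ℂ E]
    (e : ComplexDeRhamIsoFamily E) (he : e.IsNatural) (hr : IsRationalDeRhamFamily e k)
    (m : ℕ) (Y : SchemeOver ℂ) [IsAffine Y.left] [SmoothOfRelativeDimension m Y.hom]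
    (A : AnalyticModel E m Y) (A' : AnalyticModel E m (conjugateVariety σ Y))
    (ξ : AlgFormExpr Y k) (hξ : ξ.realize A ∈ cclosedSmoothForms E A.carrier k)
    (hξ' : (ξ.conj σ).realize A' ∈ cclosedSmoothForms E A'.carrier k) (c : complexBetti Y k)
    (hc : A.pullback k c = e A.carrier k (complexDeRhamCohomology.mk E A.carrier k ⟨_, hξ⟩)) :
    A'.pullback k (comparisonConj hG σ k Y c) =
      e A'.carrier k (complexDeRhamCohomology.mk E A'.carrier k ⟨_, hξ'⟩) := by
  obtain ⟨q, hq⟩ := hRig E e he hr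
  have hY := nonempty_comparisonChart σ m Y
  rw [comparisonConj_eq hG σ k hY]
  set R := Classical.choice hY
  haveI := R.smooth
  have hread : A.RefReads (ξ.smul (q : ℂ)) c := AnalyticModel.RefReads.smul_of_eq hq hξ hc
  have hout : A'.RefReads ((ξ.smul (q : ℂ)).conj σ) (chartConj hG σ k R.an R.anConj c) :=
    chartConj_readout hG σ k R.an R.anConj (hInj R.m Y (Fin R.m → ℂ) R.an R.anConj) A' hread
  exact AnalyticModel.RefReads.eq_of_conj_smul hq hout hξ'

/-- **The affine conjugation datum exists** (for given `σ`, `k`), granted (G), (G-inj) and (Rig): maps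
`θ_Y` which are (a) `σ`-semilinear, (b) natural between smooth affine `ℂ`-schemes and (c) computed by
charts — the hypothesis of `chartConjugation_canonical_of_affine` at `(σ, k)`.
[cite: CharlesSchnell2014Notes, §11.2.2 (11.2.2)–(11.2.3)] [cite: Grothendieck1966, Thm. 1'] -/
theorem exists_affineConjugationDatum (hG : grothendieck_comparison_realize_surjective)
    (σ : ℂ ≃+* ℂ) (k : ℕ)
    (hInj : ∀ (m : ℕ) (Y : SchemeOver ℂ) [IsAffine Y.left] [SmoothOfRelativeDimension m Y.hom]
      (E : Type) [NormedAddCommGroup E] [NormedSpace ℂ E] [FiniteDimensional ℂ E]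
      (A : AnalyticModel E m Y) (A' : AnalyticModel E m (conjugateVariety σ Y))
      (ξ : AlgFormExpr Y k) (hξ : ξ.realize A ∈ cclosedSmoothForms E A.carrier k)
      (hξ' : (ξ.conj σ).realize A' ∈ cclosedSmoothForms E A'.carrier k),
      complexDeRhamCohomology.mk E A.carrier k ⟨_, hξ⟩ = 0 →
        complexDeRhamCohomology.mk E A'.carrier k ⟨_, hξ'⟩ = 0)
    (hRig : ∀ (E : Type) [NormedAddCommGroup E] [NormedSpace ℂ E] [FiniteDimensional ℂ E]
      (e : ComplexDeRhamIsoFamily E), e.IsNatural → IsRationalDeRhamFamily e k →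
      ∃ q : ℚ, ∀ (M : Type) [TopologicalSpace M] [ChartedSpace E M] [IsManifold 𝓘(ℝ, E) ∞ M]
        [T2Space M] [SigmaCompactSpace M] (x : complexDeRhamCohomology E M k),
        e M k x = (q : ℂ) • (integrationDeRhamIsoFamily E).complexify M k x) :
    ∃ θ : ∀ Y : SchemeOver ℂ, complexBetti Y k → complexBetti (conjugateVariety σ Y) k,
      (∀ (Y : SchemeOver ℂ) (a : ℂ) (c₁ c₂ : complexBetti Y k),
          θ Y (a • c₁ + c₂) = σ a • θ Y c₁ + θ Y c₂) ∧
      (∀ ⦃Y Y' : SchemeOver ℂ⦄ (g : Y' ⟶ Y) (m m' : ℕ) [_root_.AlgebraicGeometry.IsAffine Y.left]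
          [_root_.AlgebraicGeometry.SmoothOfRelativeDimension m Y.hom]
          [_root_.AlgebraicGeometry.IsAffine Y'.left]
          [_root_.AlgebraicGeometry.SmoothOfRelativeDimension m' Y'.hom] (c : complexBetti Y k),
          θ Y' (complexBetti.map g k c) = complexBetti.map (conjHom σ g) k (θ Y c)) ∧
      (∀ (E : Type) [NormedAddCommGroup E] [NormedSpace ℂ E] [FiniteDimensional ℂ E]
        (e : ComplexDeRhamIsoFamily E), e.IsNatural → IsRationalDeRhamFamily e k →
        ∀ (m : ℕ) (Y : SchemeOver ℂ) [_root_.AlgebraicGeometry.IsAffine Y.left]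
          [_root_.AlgebraicGeometry.SmoothOfRelativeDimension m Y.hom]
          (A : AnalyticModel E m Y) (A' : AnalyticModel E m (conjugateVariety σ Y))
          (ξ : AlgFormExpr Y k) (hξ : ξ.realize A ∈ cclosedSmoothForms E A.carrier k)
          (hξ' : (ξ.conj σ).realize A' ∈ cclosedSmoothForms E A'.carrier k) (c : complexBetti Y k),
          A.pullback k c = e A.carrier k (complexDeRhamCohomology.mk E A.carrier k ⟨_, hξ⟩) →
          A'.pullback k (θ Y c) =
            e A'.carrier k (complexDeRhamCohomology.mk E A'.carrier k ⟨_, hξ'⟩)) :=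
  ⟨comparisonConj hG σ k, comparisonConj_smul_add hG σ k hInj,
    fun _ _ g m m' _ _ _ _ c ↦ comparisonConj_map hG σ k hInj g m m' c,
    fun E _ _ _ e he hr m Y _ _ A A' ξ hξ hξ' c hc ↦
      comparisonConj_chart hG σ k hInj hRig E e he hr m Y A A' ξ hξ hξ' c hc⟩

end Affine

/-! ### §5 The reduction theorem -/

/-- **`chartConjugation_canonical` from the comparison datum.** The named fact
`chartConjugation_canonical` (conjugation of cohomology is canonical, `σ`-semilinear, natural for
morphisms into smooth projective varieties from smooth projective or smooth affine sources, and
computed by charts on smooth affine varieties) HOLDS as soon as: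
(G) `grothendieck_comparison_realize_surjective` — every complex de Rham class on the analytification
of a smooth affine `Y` is the class of a realised algebraic form expression (Grothendieck 1966,
Thm. 1′, surjectivity);
(G-inj) for `Y` smooth affine, models `A`, `A'` of `Y`, `Y^σ` on one model space and an expression `ξ`
with closed realisations, `[ξ.realize A] = 0 → [(ξ.conj σ).realize A'] = 0` (Grothendieck 1966, Thm. 1′,
injectivity, carried along Charles–Schnell's isomorphism of algebraic de Rham complexes `α ↦ α^σ`,
(11.2.2));
(Rig) every natural complex de Rham family on `E`-manifolds which is rationally normalised in degree
`k` equals `q · (∫ ⊗ ℂ)` in degree `k` on all `E`-manifolds for one `q ∈ ℚ` (rigidity of natural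
transformations of `Hᵏ(–; ℂ)`: Steenrod representability up to odd multiples, Conner–Floyd (15.3),
with universal coefficients; rationality from the normalisation on tori).
Construction: the affine conjugation datum of §4 (`exists_affineConjugationDatum`: `θ_Y c` read through
the conjugate of a Grothendieck representative of `c`, chart-independent by (G-inj) and the uniqueness
of analytifications, `σ`-semilinear and natural on presentations, and satisfying the chart clause for
every admissible family by (Rig) because `σ` fixes `ℚ`), extended to all `ℂ`-schemes along Jouanolou
charts by `chartConjugation_canonical_of_affine`.
[cite: CharlesSchnell2014Notes, §11.2.2 (11.2.2)–(11.2.3) and Thm. 11.1.2]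
[cite: Grothendieck1966, Thm. 1'] [cite: ConnerFloyd1964, (15.3)] -/
theorem chartConjugation_canonical_of_comparison (hG : grothendieck_comparison_realize_surjective)
    (hInj : ∀ (σ : ℂ ≃+* ℂ) (m : ℕ) (Y : SchemeOver ℂ) [_root_.AlgebraicGeometry.IsAffine Y.left]
      [_root_.AlgebraicGeometry.SmoothOfRelativeDimension m Y.hom]
      (E : Type) [NormedAddCommGroup E] [NormedSpace ℂ E] [FiniteDimensional ℂ E]
      (A : AnalyticModel E m Y) (A' : AnalyticModel E m (conjugateVariety σ Y)) (k : ℕ)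
      (ξ : AlgFormExpr Y k) (hξ : ξ.realize A ∈ cclosedSmoothForms E A.carrier k)
      (hξ' : (ξ.conj σ).realize A' ∈ cclosedSmoothForms E A'.carrier k),
      complexDeRhamCohomology.mk E A.carrier k ⟨_, hξ⟩ = 0 →
        complexDeRhamCohomology.mk E A'.carrier k ⟨_, hξ'⟩ = 0)
    (hRig : ∀ (k : ℕ) (E : Type) [NormedAddCommGroup E] [NormedSpace ℂ E] [FiniteDimensional ℂ E]
      (e : ComplexDeRhamIsoFamily E), e.IsNatural → IsRationalDeRhamFamily e k →
      ∃ q : ℚ, ∀ (M : Type) [TopologicalSpace M] [ChartedSpace E M] [IsManifold 𝓘(ℝ, E) ∞ M]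
        [T2Space M] [SigmaCompactSpace M] (x : complexDeRhamCohomology E M k),
        e M k x = (q : ℂ) • (integrationDeRhamIsoFamily E).complexify M k x) :
    chartConjugation_canonical :=
  chartConjugation_canonical_of_affine fun σ k ↦
    exists_affineConjugationDatum hG σ k
      (fun m Y _ _ E _ _ _ A A' ξ hξ hξ' h0 ↦ hInj σ m Y E A A' k ξ hξ hξ' h0) (hRig k)

end HodgeTheory

end Literature.AlgebraicGeometry.HodgeTheory

end
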